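import Summits.CriticalPhenomena.PercolationContinuityZ3.Theorems.PercNearOneGluingNoHeavyLowerTailSahiHubTwoLevel
import Mathlib.Tactic.Linarith
import Mathlib.Tactic.Positivity
import HarnessLib

/-!
# `NoHeavyLowerTail` (crux stmt-CriticalPhenomena-4575), P2 — T₁(|C|=1): the hub two-level form SPLITS OFF THE HUB BIAS

Seat `prim-masterthm-p2`, gen 28 (memo `FROM-prim-masterthm-p2-g28-H-FREE-FLOW.md` §7; `--supports stmt-CriticalPhenomena-4575`).
No `sorry`, no named facts, standard axioms.

SETTING as in `…SahiHubTwoLevel`: hub coin `Z = Fin 2` with weight `wZ` (`wZ 0 + wZ 1 = 1`, `t := wZ 1`), blocks `α, β` with weights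
`wA, wB`, nested sections `f i z : α → ℝ`, `g j z : β → ℝ` (c-level `i, j`, hub level `z`), `h z : α → β → ℝ`; `TL = twoLevel` is the hub
two-level form whose nonnegativity gives Kahn's `C₃` on T₁(|C|=1) (`sahiE_three_nonneg_T1C1_of_twoLevel_nonneg` in `…SahiHubTwoLevelE3`).
All level moments are those of `…SahiHubTwoLevel` (`Fm, gm, Sgy, Sgh, Ybar, Hb`).

* `levelForm z z'` — the ONE-LEVEL form of the level-`z` sections with the constants (means) taken from level `z'`:
  `L(z;z') = 2E_z[f₀g₀h] + 2E_z[f₁g₁h] − F₀(z')E_z[g₁h] − F₁(z')E_z[g₀h] − G₀(z')E_z[f₁h] − G₁(z')E_z[f₀h] − (F₁−F₀)(z')(G₁−G₀)(z')E_z[h]`.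
  `L(z;z)` is the genuine one-level ("independent tops") form of level `z`; `L(0;1)`, `L(1;0)` are the CROSSED forms.
* `crossN = ΔF₁ΔG₀ + ΔF₀ΔG₁` (`Δ` = level 1 minus level 0) and **`crossForm = L(0;1) + L(1;0) − crossN·E_1[h]`** — a quantity that does
  NOT involve the hub weight.
* **`twoLevel_eq_crossForm` (THE SPLITTING IDENTITY).**  With `w₀ = wZ 0`, `w₁ = wZ 1`, `w₀ + w₁ = 1`:
  `TL = w₀w₁·crossForm + w₀²·L(0;0) + w₁²·L(1;1) + w₁w₀²·crossN·(E_1[h] − E_0[h])`.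
  (Equivalently `TL(t) = (1−t)L₀ + tL₁ + t(1−t)(B₀ − crossN·h̄)`, a cubic in `t`, and `crossForm = L₀ + L₁ + B₀ − crossN·E_1[h]`.)
* **`twoLevel_nonneg_of_crossForm_nonneg`.**  Hence `TL ≥ 0` at EVERY hub bias as soon as (i) the two one-level forms are `≥ 0`
  (the one-level law: PLUS′ with independent tops, `…SahiTwoLevelIndependentTops`, here taken as hypotheses on the abstract blocks)
  and (ii) the t-FREE inequality `crossForm ≥ 0` holds; the remaining terms are visibly nonnegative for sections increasing in `z`.
So T₁(|C|=1) for all hub biases is reduced to ONE bias-free two-level inequality, `crossForm ≥ 0` ("I3" of the memo): exact census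
0 failures / 520 000 random hub cells (kit j224978, j224979; tight cases only on faces), and its h-free type-flow LP (cf. `…TypeFlow`) is
feasible at all 15 025 tested mean points (kit j225002).  HONEST LABEL: identity + reduction; `crossForm ≥ 0`, T₁(|C|=1), `C₃` OPEN. [this work]
-/

noncomputable section

open scoped Classical

namespace Summit.CriticalPhenomena.PercolationContinuityZ3.Theorems

namespace SahiHubTwoLevel

open Finset

section Defs

variable {α β : Type} [Fintype α] [Fintype β]
  (wA : α → ℝ) (wB : β → ℝ) (f : Fin 2 → Fin 2 → α → ℝ) (g : Fin 2 → Fin 2 → β → ℝ) (h : Fin 2 → α → β → ℝ)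

/-- `L(z;z')`: the one-level form of the level-`z` sections with constants from level `z'`:
`2E_z[f₀g₀h] + 2E_z[f₁g₁h] − F₀(z')E_z[g₁h] − F₁(z')E_z[g₀h] − G₀(z')E_z[f₁h] − G₁(z')E_z[f₀h] − (F₁−F₀)(z')(G₁−G₀)(z')·E_z[h]`.
`L(z;z)` is the one-level ("independent tops") form of level `z`. [this work] -/
def levelForm (z z' : Fin 2) : ℝ :=
  2 * Sgy wA wB f g h 0 0 z + 2 * Sgy wA wB f g h 1 1 z
    - Fm wA f 0 z' * Sgh wA wB g h 1 z - Fm wA f 1 z' * Sgh wA wB g h 0 z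
    - gm wB g 0 z' * Ybar wA wB f h 1 z - gm wB g 1 z' * Ybar wA wB f h 0 z
    - (Fm wA f 1 z' - Fm wA f 0 z') * (gm wB g 1 z' - gm wB g 0 z') * Hb wA wB h z

/-- `N = ΔF₁·ΔG₀ + ΔF₀·ΔG₁`, `ΔF_i = F_i(1) − F_i(0)`, `ΔG_j = G_j(1) − G_j(0)` (nonnegative for sections increasing in `z`). [this work] -/
def crossN : ℝ :=
  (Fm wA f 1 1 - Fm wA f 1 0) * (gm wB g 0 1 - gm wB g 0 0) + (Fm wA f 0 1 - Fm wA f 0 0) * (gm wB g 1 1 - gm wB g 1 0)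

/-- **The bias-free cross form** `I3 = L(0;1) + L(1;0) − N·E_1[h]` (no hub weight anywhere). [this work] -/
def crossForm : ℝ :=
  levelForm wA wB f g h 0 1 + levelForm wA wB f g h 1 0 - crossN wA wB f g * Hb wA wB h 1

end Defs

section Split

variable {α β : Type} [Fintype α] [Fintype β]
  {wA : α → ℝ} {wB : β → ℝ} {wZ : Fin 2 → ℝ} {f : Fin 2 → Fin 2 → α → ℝ} {g : Fin 2 → Fin 2 → β → ℝ} {h : Fin 2 → α → β → ℝ}

/-- **THE SPLITTING IDENTITY**: `TL = w₀w₁·I3 + w₀²·L(0;0) + w₁²·L(1;1) + w₁w₀²·N·(E_1[h] − E_0[h])` whenever `w₀ + w₁ = 1`. [this work] -/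
theorem twoLevel_eq_crossForm (hZ : wZ 0 + wZ 1 = 1) :
    twoLevel wA wB wZ f g h =
      wZ 0 * wZ 1 * crossForm wA wB f g h + wZ 0 ^ 2 * levelForm wA wB f g h 0 0 + wZ 1 ^ 2 * levelForm wA wB f g h 1 1
        + wZ 1 * wZ 0 ^ 2 * (crossN wA wB f g * (Hb wA wB h 1 - Hb wA wB h 0)) := by
  have h0 : wZ 0 = 1 - wZ 1 := by linarith
  unfold twoLevel fbar gbar hbar crossForm levelForm crossN
  simp only [Fin.sum_univ_two]
  rw [h0]
  ring

/-- `F_i(1) ≥ F_i(0)` for sections increasing in the hub level (nonnegative weights). [this work] -/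
theorem Fm_sub_nonneg (hA0 : ∀ a, 0 ≤ wA a) (hfz : ∀ i a, f i 0 a ≤ f i 1 a) (i : Fin 2) :
    0 ≤ Fm wA f i 1 - Fm wA f i 0 := by
  have e : Fm wA f i 1 - Fm wA f i 0 = ∑ a, wA a * (f i 1 a - f i 0 a) := by
    unfold Fm
    rw [← sum_sub_distrib]
    exact sum_congr rfl fun a _ => by ring
  rw [e]
  exact sum_nonneg fun a _ => mul_nonneg (hA0 a) (sub_nonneg.2 (hfz i a))

/-- `G_j(1) ≥ G_j(0)` for sections increasing in the hub level (nonnegative weights). [this work] -/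
theorem gm_sub_nonneg (hB0 : ∀ b, 0 ≤ wB b) (hgz : ∀ j b, g j 0 b ≤ g j 1 b) (j : Fin 2) :
    0 ≤ gm wB g j 1 - gm wB g j 0 := by
  have e : gm wB g j 1 - gm wB g j 0 = ∑ b, wB b * (g j 1 b - g j 0 b) := by
    unfold gm
    rw [← sum_sub_distrib]
    exact sum_congr rfl fun b _ => by ring
  rw [e]
  exact sum_nonneg fun b _ => mul_nonneg (hB0 b) (sub_nonneg.2 (hgz j b))

/-- `E_1[h] ≥ E_0[h]` for `h` increasing in the hub level (nonnegative weights). [this work] -/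
theorem Hb_sub_nonneg (hA0 : ∀ a, 0 ≤ wA a) (hB0 : ∀ b, 0 ≤ wB b) (hhz : ∀ a b, h 0 a b ≤ h 1 a b) :
    0 ≤ Hb wA wB h 1 - Hb wA wB h 0 := by
  have e : Hb wA wB h 1 - Hb wA wB h 0 = ∑ b, wB b * ∑ a, wA a * (h 1 a b - h 0 a b) := by
    unfold Hb Hsl
    rw [← sum_sub_distrib]
    refine sum_congr rfl fun b _ => ?_
    rw [← mul_sub, ← sum_sub_distrib]
    exact congrArg _ (sum_congr rfl fun a _ => by ring)
  rw [e]
  exact sum_nonneg fun b _ => mul_nonneg (hB0 b) (sum_nonneg fun a _ => mul_nonneg (hA0 a) (sub_nonneg.2 (hhz a b)))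

/-- `N = ΔF₁ΔG₀ + ΔF₀ΔG₁ ≥ 0` for sections increasing in the hub level. [this work] -/
theorem crossN_nonneg (hA0 : ∀ a, 0 ≤ wA a) (hB0 : ∀ b, 0 ≤ wB b)
    (hfz : ∀ i a, f i 0 a ≤ f i 1 a) (hgz : ∀ j b, g j 0 b ≤ g j 1 b) : 0 ≤ crossN wA wB f g := by
  unfold crossN
  exact add_nonneg (mul_nonneg (Fm_sub_nonneg hA0 hfz 1) (gm_sub_nonneg hB0 hgz 0))
    (mul_nonneg (Fm_sub_nonneg hA0 hfz 0) (gm_sub_nonneg hB0 hgz 1))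

/-- **REDUCTION OF T₁(|C|=1) TO THE BIAS-FREE CROSS FORM.**  If the two one-level forms `L(0;0)`, `L(1;1)` are nonnegative (the
one-level law) and `crossForm ≥ 0`, then `TL ≥ 0` at every hub bias `wZ` (`wZ ≥ 0`, `wZ 0 + wZ 1 = 1`), for sections increasing in the
hub level.  Combine with `sahiE_three_nonneg_T1C1_of_twoLevel_nonneg`. [this work] -/
theorem twoLevel_nonneg_of_crossForm_nonneg (hZ0 : 0 ≤ wZ 0) (hZ1 : 0 ≤ wZ 1) (hZ : wZ 0 + wZ 1 = 1)
    (hA0 : ∀ a, 0 ≤ wA a) (hB0 : ∀ b, 0 ≤ wB b)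
    (hfz : ∀ i a, f i 0 a ≤ f i 1 a) (hgz : ∀ j b, g j 0 b ≤ g j 1 b) (hhz : ∀ a b, h 0 a b ≤ h 1 a b)
    (hL0 : 0 ≤ levelForm wA wB f g h 0 0) (hL1 : 0 ≤ levelForm wA wB f g h 1 1) (hX : 0 ≤ crossForm wA wB f g h) :
    0 ≤ twoLevel wA wB wZ f g h := by
  rw [twoLevel_eq_crossForm hZ]
  have hN := crossN_nonneg hA0 hB0 hfz hgz
  have hH := Hb_sub_nonneg hA0 hB0 hhz
  positivity

/-- The bias enters `TL` only through the explicit weights: at EVERY bias, `TL ≥ w₀w₁·crossForm` once the one-level forms are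
nonnegative (so a bias-free lower bound certifies all biases at once). [this work] -/
theorem twoLevel_ge_crossForm (hZ1 : 0 ≤ wZ 1) (hZ : wZ 0 + wZ 1 = 1)
    (hA0 : ∀ a, 0 ≤ wA a) (hB0 : ∀ b, 0 ≤ wB b)
    (hfz : ∀ i a, f i 0 a ≤ f i 1 a) (hgz : ∀ j b, g j 0 b ≤ g j 1 b) (hhz : ∀ a b, h 0 a b ≤ h 1 a b)
    (hL0 : 0 ≤ levelForm wA wB f g h 0 0) (hL1 : 0 ≤ levelForm wA wB f g h 1 1) :
    wZ 0 * wZ 1 * crossForm wA wB f g h ≤ twoLevel wA wB wZ f g h := by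
  rw [twoLevel_eq_crossForm hZ]
  have hN := crossN_nonneg hA0 hB0 hfz hgz
  have hH := Hb_sub_nonneg hA0 hB0 hhz
  have h1 : 0 ≤ wZ 0 ^ 2 * levelForm wA wB f g h 0 0 := by positivity
  have h2 : 0 ≤ wZ 1 ^ 2 * levelForm wA wB f g h 1 1 := by positivity
  have h3 : 0 ≤ wZ 1 * wZ 0 ^ 2 * (crossN wA wB f g * (Hb wA wB h 1 - Hb wA wB h 0)) := by positivity
  linarith

end Split

end SahiHubTwoLevel

end Summit.CriticalPhenomena.PercolationContinuityZ3.Theorems
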